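import Summits.SmoothPoincare4.SmoothPoincare4.Theorems.SoloInformedPretzelSurgeryTietze17
import Summits.SmoothPoincare4.SmoothPoincare4.Theorems.SoloInformedPretzelSurgeryTietze23
import Summits.SmoothPoincare4.SmoothPoincare4.Theorems.SoloInformedBinaryIcosahedralClasses

/-!
# The `A₅`-order of the meridian in the icosahedral surgery groups of `P(-2,3,7)` and `P(-2,3,9)`

The invariant `d(K, p)` of the paper (Theorem B / Corollary C: `Σ_q(S⁴, τ^p ρ K) ≅ S⁴` needs
`d ∤ q`) is the order, in `A₅ = I*/{±1}`, of the image of the meridian under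
`π₁ S³_p(K) ≅ ℤ/p × I*`; equivalently `μ^q` is central iff `d ∣ q`.

Kernel content of this file (namespace `PretzelSurgery`):
* unconditionally, for the explicit epimorphisms `ρ17 : G17 ↠ ℤ/17 × SL(2,𝔽₅)` and
  `ρ23 : G23 ↠ ℤ/23 × SL(2,𝔽₅)` of `SoloInformedPretzelSurgeryQuotients`: the `SL(2,𝔽₅)`-component of
  `ρ(μ)` is conjugate to `z` (order `10`, `A₅`-order `5`) for `P(-2,3,7)`, slope `17`, and to `y`
  (order `6`, `A₅`-order `3`) for `P(-2,3,9)`, slope `23`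
  (`sl17_mu_pow_mem_center_iff`, `sl23_mu_pow_mem_center_iff`);
* for any ISOMORPHISM `ρ17` / `ρ23` (which the external coset-enumeration certificates give through
  `G17_of_certificate` / `G23_of_certificate`): `μ^q ∈ Z(G17) ↔ 5 ∣ q` and `μ^q ∈ Z(G23) ↔ 3 ∣ q`,
  i.e. `d(P(-2,3,7), 17) = 5` and `d(P(-2,3,9), 23) = 3` (`mu17_pow_mem_center_iff`,
  `mu23_pow_mem_center_iff`, and the `_of_certificate` forms).
-/

namespace Summit.SmoothPoincare4.SmoothPoincare4.Theorems
namespace PretzelSurgery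

open MatrixGroups BinaryIcosahedral Subgroup

/-! ### Slope 17 on `P(-2,3,7)`: the meridian is arc `9`, `ρ17(μ) = (1, M17 9)` with `M17 9 ~ z` -/

/-- `ρ17` on the meridian arc. -/
theorem ρ17_mu : ρ17 (PresentedGroup.of 9) = (Multiplicative.ofAdd 1, M17 9) := ρ17_of 9

/-- An explicit conjugator: `M17 9 = c z c⁻¹` with `c = [[0,2],[2,0]]`. -/
theorem isConj_z_M17 : IsConj z (M17 9) :=
  isConj_iff.mpr ⟨BinaryIcosahedral.sl 0 2 2 0, by decide +kernel⟩

/-- The `SL(2,𝔽₅)`-component of `ρ17(μ)` has `A₅`-order `5`: its `q`-th power is central iff `5 ∣ q`. -/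
theorem sl17_mu_pow_mem_center_iff (q : ℕ) :
    (ρ17 (PresentedGroup.of 9)).2 ^ q ∈ center (SL(2, ZMod 5)) ↔ 5 ∣ q := by
  rw [ρ17_mu]
  exact (pow_mem_center_iff_of_isConj isConj_z_M17 q).trans (z_pow_mem_center_iff q)

/-- Transport of centrality of powers along a bijective `ρ17`: `g^q ∈ Z(G17)` iff the
`SL(2,𝔽₅)`-component of `ρ17(g)^q` is central (the `ℤ/17` factor is abelian). -/
theorem pow_mem_center_iff_of_bijective17 (hρ : Function.Bijective ρ17) (g : G17) (q : ℕ) :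
    g ^ q ∈ center G17 ↔ (ρ17 g).2 ^ q ∈ center (SL(2, ZMod 5)) := by
  rw [Subgroup.mem_center_iff, Subgroup.mem_center_iff]
  constructor
  · intro h k
    obtain ⟨g', hg'⟩ := hρ.2 ((1, k) : K17)
    have := congrArg (fun t => (ρ17 t).2) (h g')
    simpa [map_mul, map_pow, hg'] using this
  · intro h g'
    apply hρ.1
    simp only [map_mul, map_pow]
    exact Prod.ext (mul_comm _ _) (by simpa using h (ρ17 g').2)

/-- `d(P(-2,3,7), 17) = 5`: if `ρ17` is an isomorphism then `μ^q` is central in `G17` iff `5 ∣ q`. -/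
theorem mu17_pow_mem_center_iff (hρ : Function.Bijective ρ17) (q : ℕ) :
    (PresentedGroup.of 9 : G17) ^ q ∈ center G17 ↔ 5 ∣ q :=
  (pow_mem_center_iff_of_bijective17 hρ _ q).trans (sl17_mu_pow_mem_center_iff q)

/-- The same from the external enumeration certificate `|G17c| ≤ 2040`. -/
theorem mu17_pow_mem_center_iff_of_certificate [Finite G17c] (h : Nat.card G17c ≤ 2040) (q : ℕ) :
    (PresentedGroup.of 9 : G17) ^ q ∈ center G17 ↔ 5 ∣ q :=
  mu17_pow_mem_center_iff (G17_of_certificate h).1 q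

/-! ### Slope 23 on `P(-2,3,9)`: the meridian is arc `11`, `ρ23(μ) = (1, M23 11)` with `M23 11 ~ y` -/

/-- `ρ23` on the meridian arc. -/
theorem ρ23_mu : ρ23 (PresentedGroup.of 11) = (Multiplicative.ofAdd 1, M23 11) := ρ23_of 11

/-- An explicit conjugator: `M23 11 = c y c⁻¹` with `c = [[1,2],[0,1]]`. -/
theorem isConj_y_M23 : IsConj y (M23 11) :=
  isConj_iff.mpr ⟨BinaryIcosahedral.sl 1 2 0 1, by decide +kernel⟩

/-- The `SL(2,𝔽₅)`-component of `ρ23(μ)` has `A₅`-order `3`: its `q`-th power is central iff `3 ∣ q`. -/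
theorem sl23_mu_pow_mem_center_iff (q : ℕ) :
    (ρ23 (PresentedGroup.of 11)).2 ^ q ∈ center (SL(2, ZMod 5)) ↔ 3 ∣ q := by
  rw [ρ23_mu]
  exact (pow_mem_center_iff_of_isConj isConj_y_M23 q).trans (y_pow_mem_center_iff q)

/-- Transport of centrality of powers along a bijective `ρ23`. -/
theorem pow_mem_center_iff_of_bijective23 (hρ : Function.Bijective ρ23) (g : G23) (q : ℕ) :
    g ^ q ∈ center G23 ↔ (ρ23 g).2 ^ q ∈ center (SL(2, ZMod 5)) := by
  rw [Subgroup.mem_center_iff, Subgroup.mem_center_iff]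
  constructor
  · intro h k
    obtain ⟨g', hg'⟩ := hρ.2 ((1, k) : K23)
    have := congrArg (fun t => (ρ23 t).2) (h g')
    simpa [map_mul, map_pow, hg'] using this
  · intro h g'
    apply hρ.1
    simp only [map_mul, map_pow]
    exact Prod.ext (mul_comm _ _) (by simpa using h (ρ23 g').2)

/-- `d(P(-2,3,9), 23) = 3`: if `ρ23` is an isomorphism then `μ^q` is central in `G23` iff `3 ∣ q`. -/
theorem mu23_pow_mem_center_iff (hρ : Function.Bijective ρ23) (q : ℕ) :
    (PresentedGroup.of 11 : G23) ^ q ∈ center G23 ↔ 3 ∣ q :=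
  (pow_mem_center_iff_of_bijective23 hρ _ q).trans (sl23_mu_pow_mem_center_iff q)

/-- The same from the external enumeration certificate `|G23c| ≤ 2760`. -/
theorem mu23_pow_mem_center_iff_of_certificate [Finite G23c] (h : Nat.card G23c ≤ 2760) (q : ℕ) :
    (PresentedGroup.of 11 : G23) ^ q ∈ center G23 ↔ 3 ∣ q :=
  mu23_pow_mem_center_iff (G23_of_certificate h).1 q

end PretzelSurgery
end Summit.SmoothPoincare4.SmoothPoincare4.Theorems
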